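import Mathlib
import HarnessLib
import Summits.ValiantsHypothesis.ValiantsHypothesis.Theorems.LacunarySymmetroidMatrixDescartesOsculationLawPeelBranchOrdering
import Summits.ValiantsHypothesis.ValiantsHypothesis.Theorems.LacunarySymmetroidMatrixDescartesOsculationLawPeelReflect

/-!
# ValiantsHypothesis / LacunarySymmetroid — crux `MatrixDescartes` (stmt-ValiantsHypothesis-18050, V1),
# line `Cruxes/MatrixDescartes/Lines/osculation_law.lean` («osculation-law»), stub `stub_peel` (ALL ranks):
# END CHARGES — families of branches meeting at a ZERO end, an ESCAPE end, or ALIVE at the horizon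
# (piece (γ4) of NOTE-p7g12-peel-general-r-sizing.md §6)

Rank-free FAMILY forms of val-lit-p7 g12's chain lemmas (`lt_of_lt_solutions`,
`succ_le_rootMultiplicity_of_branches_tendsto_zero`, `card_le_natDegree_of_roots`, p625021), for a finset of
continuous positive solutions of `Φ = 0` on a common interval that are pairwise distinct:
* `exists_sorted_chain` — they can be re-indexed as a chain `β 0 < β 1 < ⋯ < β k` on the whole interval (sort at one
  abscissa; branches do not cross);
* **`card_le_rootMultiplicity_of_tendsto_zero`** — if all tend to `0` at `ω⁻` then `#family ≤ rootMultiplicity 0 (P ω)`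
  (the multiplicity half of the ZERO-end charge);
* **`card_le_rootMultiplicity_reflect_of_tendsto_atTop`** — COEFFICIENT FORM `Φ = Σ_{k≤r} X₁^k·ι(a_k)`: if all tend to
  `+∞` at `ω⁻` then `#family ≤ rootMultiplicity 0` of the REFLECTED fibre `Σ_k X^k C(a_{r−k}(ω))` (inverses of the
  sorted chain, reversed, fed to the zero-end lemma through `…PeelReflect.eval_reflect_coeffForm_inv`);
* **`card_le_natDegree_of_alive`** — solutions continuous and positive up to the horizon `B` inject into the roots
  of `P B`, so `#family ≤ natDegree (P B)`.
Honest framing: rank-free LEMMAS toward the OPEN stub `stub_peel` (all `r`); nothing of the summit is proved;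
`MatrixDescartes`, the LAW and `VP ≠ VNP` are NOT proved.  No definitions, no named facts.  (val-lit-p4 g13, helper
`--supports stmt-ValiantsHypothesis-18050`; desk RULING #279 (a).)
-/

-- `Summit.ValiantsHypothesis.ValiantsHypothesis.…` is the tree's mandated single-conjunct layout (Sub = Summit).
set_option linter.dupNamespace false

noncomputable section

namespace Summit.ValiantsHypothesis.ValiantsHypothesis.Theorems.LacunarySymmetroidMatrixDescartes

open Polynomial Set Filter
open MvPolynomial (pderiv)
open scoped BigOperators Topology

namespace OsculationPeel

section

variable (Φ : MvPolynomial (Fin 2) ℝ) (P : ℝ → ℝ[X])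
    (hP : ∀ t b, (P t).eval b = MvPolynomial.eval ![t, b] Φ) (hsplit : ∀ t, 0 < t → (P t).Splits)
    (hfin : {p : Fin 2 → ℝ | 0 < p 0 ∧ 0 < p 1 ∧ MvPolynomial.eval p Φ = 0 ∧
      MvPolynomial.eval p
        (MvPolynomial.X 0 * MvPolynomial.pderiv 0 (MvPolynomial.X 0 * MvPolynomial.pderiv 0 Φ)
            * (MvPolynomial.X 1 * MvPolynomial.pderiv 1 Φ) ^ 2
          - 2 * (MvPolynomial.X 0 * MvPolynomial.pderiv 0 (MvPolynomial.X 1 * MvPolynomial.pderiv 1 Φ))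
            * (MvPolynomial.X 0 * MvPolynomial.pderiv 0 Φ) * (MvPolynomial.X 1 * MvPolynomial.pderiv 1 Φ)
          + MvPolynomial.X 1 * MvPolynomial.pderiv 1 (MvPolynomial.X 1 * MvPolynomial.pderiv 1 Φ)
            * (MvPolynomial.X 0 * MvPolynomial.pderiv 0 Φ) ^ 2) = 0}.Finite)
    (hgp : ∀ p ∈ {p : Fin 2 → ℝ | 0 < p 0 ∧ 0 < p 1 ∧ MvPolynomial.eval p Φ = 0 ∧
      MvPolynomial.eval p
        (MvPolynomial.X 0 * MvPolynomial.pderiv 0 (MvPolynomial.X 0 * MvPolynomial.pderiv 0 Φ)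
            * (MvPolynomial.X 1 * MvPolynomial.pderiv 1 Φ) ^ 2
          - 2 * (MvPolynomial.X 0 * MvPolynomial.pderiv 0 (MvPolynomial.X 1 * MvPolynomial.pderiv 1 Φ))
            * (MvPolynomial.X 0 * MvPolynomial.pderiv 0 Φ) * (MvPolynomial.X 1 * MvPolynomial.pderiv 1 Φ)
          + MvPolynomial.X 1 * MvPolynomial.pderiv 1 (MvPolynomial.X 1 * MvPolynomial.pderiv 1 Φ)
            * (MvPolynomial.X 0 * MvPolynomial.pderiv 0 Φ) ^ 2) = 0},
        MvPolynomial.eval p (MvPolynomial.pderiv 1 Φ) ≠ 0)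

include hP hsplit hfin hgp

/-- **Sorting a family of branches into a chain.**  A finset of `k + 1` continuous positive solutions of `Φ = 0` on
`(s, ω)`, `s > 0`, pairwise distinct at every abscissa, can be indexed `β 0, …, β k` with `β i t < β (i+1) t` for
ALL `t ∈ (s, ω)` (sort the values at one abscissa; `lt_of_lt_solutions` propagates the order). [folklore] -/
theorem exists_sorted_chain {ι : Type*} (T : Finset ι) (f : ι → ℝ → ℝ) {s ω : ℝ} (hs : 0 < s) (hsω : s < ω)
    {k : ℕ} (hcard : T.card = k + 1)
    (hcont : ∀ i ∈ T, ContinuousOn (f i) (Ioo s ω)) (hpos : ∀ i ∈ T, ∀ t ∈ Ioo s ω, 0 < f i t)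
    (hsol : ∀ i ∈ T, ∀ t ∈ Ioo s ω, MvPolynomial.eval ![t, f i t] Φ = 0)
    (hinj : ∀ i ∈ T, ∀ j ∈ T, i ≠ j → ∀ t ∈ Ioo s ω, f i t ≠ f j t) :
    ∃ β : ℕ → ℝ → ℝ, (∀ n, n < k + 1 → ∃ i ∈ T, β n = f i) ∧
      ∀ n, n + 1 < k + 1 → ∀ t ∈ Ioo s ω, β n t < β (n + 1) t := by
  classical
  set tref : ℝ := (s + ω) / 2 with htref
  have href : tref ∈ Ioo s ω := ⟨by rw [htref]; linarith, by rw [htref]; linarith⟩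
  -- the values at `tref`, sorted
  set V : Finset ℝ := T.image (fun i => f i tref) with hV
  have hVcard : V.card = k + 1 := by
    rw [hV, Finset.card_image_of_injOn, hcard]
    intro i hi j hj hij
    by_contra hne
    exact hinj i hi j hj hne tref href hij
  set e := V.orderEmbOfFin hVcard with he
  have hex : ∀ j : Fin (k + 1), ∃ i, i ∈ T ∧ f i tref = e j := by
    intro j
    have hm : e j ∈ V := Finset.orderEmbOfFin_mem V hVcard j
    rw [hV, Finset.mem_image] at hm
    obtain ⟨i, hi, hfi⟩ := hm
    exact ⟨i, hi, hfi⟩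
  choose g hgT hgf using hex
  refine ⟨fun n t => if h : n < k + 1 then f (g ⟨n, h⟩) t else 0, ?_, ?_⟩
  · intro n hn
    exact ⟨g ⟨n, hn⟩, hgT _, by funext t; simp [hn]⟩
  · intro n hn t ht
    have hn' : n < k + 1 := by omega
    simp only [hn, hn', dif_pos]
    -- order at `tref`
    have hlt : f (g ⟨n, hn'⟩) tref < f (g ⟨n + 1, hn⟩) tref := by
      rw [hgf, hgf]
      exact e.strictMono (Fin.mk_lt_mk.2 (Nat.lt_succ_self n))
    -- propagate along the segment between `tref` and `t`
    set lo := min tref t with hlo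
    set hi := max tref t with hhi
    have hlo_s : s < lo := lt_min href.1 ht.1
    have hhi_ω : hi < ω := max_lt href.2 ht.2
    have hsub : Icc lo hi ⊆ Ioo s ω := fun x hx => ⟨hlo_s.trans_le hx.1, lt_of_le_of_lt hx.2 hhi_ω⟩
    have h := lt_of_lt_solutions Φ P hP hsplit hfin hgp (hs.trans hlo_s)
      (show tref ∈ Icc lo hi from ⟨min_le_left _ _, le_max_left _ _⟩)
      ((hcont _ (hgT _)).mono hsub) ((hcont _ (hgT _)).mono hsub)
      (fun x hx => hpos _ (hgT _) x (hsub hx)) (fun x hx => hsol _ (hgT _) x (hsub hx))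
      (fun x hx => hsol _ (hgT _) x (hsub hx)) hlt
    exact h t ⟨min_le_right _ _, le_max_right _ _⟩

/-- **ZERO-end charge, multiplicity half (family form).**  A finset of continuous positive solutions on `(s, ω)`,
`0 < s < ω`, pairwise distinct, all tending to `0` at `ω⁻`, has at most `rootMultiplicity 0 (P ω)` members
(`P ω ≠ 0`). [folklore; p7's `succ_le_rootMultiplicity_of_branches_tendsto_zero` on the sorted chain] -/
theorem card_le_rootMultiplicity_of_tendsto_zero {ι : Type*} (T : Finset ι) (f : ι → ℝ → ℝ) {s ω : ℝ}
    (hs : 0 < s) (hsω : s < ω) (hP0 : P ω ≠ 0)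
    (hcont : ∀ i ∈ T, ContinuousOn (f i) (Ioo s ω)) (hpos : ∀ i ∈ T, ∀ t ∈ Ioo s ω, 0 < f i t)
    (hsol : ∀ i ∈ T, ∀ t ∈ Ioo s ω, MvPolynomial.eval ![t, f i t] Φ = 0)
    (hinj : ∀ i ∈ T, ∀ j ∈ T, i ≠ j → ∀ t ∈ Ioo s ω, f i t ≠ f j t)
    (hlim : ∀ i ∈ T, Tendsto (f i) (𝓝[<] ω) (𝓝 0)) :
    T.card ≤ (P ω).rootMultiplicity 0 := by
  rcases Nat.eq_zero_or_pos T.card with h0 | hpos'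
  · rw [h0]; exact Nat.zero_le _
  · obtain ⟨k, hk⟩ : ∃ k, T.card = k + 1 := ⟨T.card - 1, by omega⟩
    obtain ⟨β, hβ, hchain⟩ := exists_sorted_chain Φ P hP hsplit hfin hgp T f hs hsω hk hcont hpos hsol hinj
    rw [hk]
    refine succ_le_rootMultiplicity_of_branches_tendsto_zero Φ P hP hsω hP0 β hchain ?_ ?_
    · intro n hn t ht
      obtain ⟨i, hi, hβi⟩ := hβ n hn
      rw [hβi]; exact hsol i hi t ht
    · intro n hn
      obtain ⟨i, hi, hβi⟩ := hβ n hn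
      rw [hβi]; exact hlim i hi

/-- **ALIVE-at-the-horizon charge.**  A finset of solutions, continuous and positive on `[s, B]` (`s > 0`) and
pairwise distinct at `s`, injects into the roots of `P B ≠ 0` by `f ↦ f(B)` (two solutions agreeing at `B` agree at
`s`, `branch_unique_of_hyperbolic`); hence `#family ≤ natDegree (P B)`. [folklore] -/
theorem card_le_natDegree_of_alive {ι : Type*} (T : Finset ι) (f : ι → ℝ → ℝ) {s B : ℝ} (hs : 0 < s)
    (hsB : s ≤ B) (hPB : P B ≠ 0)
    (hcont : ∀ i ∈ T, ContinuousOn (f i) (Icc s B)) (hpos : ∀ i ∈ T, ∀ t ∈ Icc s B, 0 < f i t)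
    (hsol : ∀ i ∈ T, ∀ t ∈ Icc s B, MvPolynomial.eval ![t, f i t] Φ = 0)
    (hinj : ∀ i ∈ T, ∀ j ∈ T, i ≠ j → f i s ≠ f j s) :
    T.card ≤ (P B).natDegree := by
  classical
  have hinjB : Set.InjOn (fun i => f i B) T := by
    intro i hi j hj hij
    by_contra hne
    have hB : B ∈ Icc s B := ⟨hsB, le_rfl⟩
    have h := branch_unique_of_hyperbolic Φ P hP hsplit hfin hgp hs hB (hcont i hi) (hcont j hj)
      (hpos i hi) (hsol i hi) (hsol j hj) hij
    exact hinj i hi j hj hne (h ⟨le_rfl, hsB⟩)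
  calc T.card = (T.image fun i => f i B).card := (Finset.card_image_of_injOn hinjB).symm
    _ ≤ (P B).natDegree := by
        refine card_le_natDegree_of_roots (P B) hPB _ fun x hx => ?_
        rw [Finset.mem_image] at hx
        obtain ⟨i, hi, rfl⟩ := hx
        rw [IsRoot, hP]
        exact hsol i hi B ⟨hsB, le_rfl⟩

end

/-- **ESCAPE-end charge, multiplicity half (coefficient form).**  For `Φ = Σ_{k≤r} X₁^k·ι(a_k)`: a finset of
continuous positive solutions on `(s, ω)`, `0 < s < ω`, pairwise distinct, all tending to `+∞` at `ω⁻`, has at most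
`rootMultiplicity 0` of the REFLECTED fibre `Σ_k X^k C(a_{r−k}(ω))` members (the inverses, in reversed order, are a
chain of solutions of the reflected curve tending to `0`). [folklore] -/
theorem card_le_rootMultiplicity_reflect_of_tendsto_atTop (r : ℕ) (a : ℕ → ℝ[X])
    (hsplit : ∀ t, 0 < t → (∑ k ∈ Finset.range (r + 1), (X : ℝ[X]) ^ k * Polynomial.C ((a k).eval t)).Splits)
    (hfin : {p : Fin 2 → ℝ | 0 < p 0 ∧ 0 < p 1 ∧ MvPolynomial.eval p (∑ k ∈ Finset.range (r + 1),
        (MvPolynomial.X 1 : MvPolynomial (Fin 2) ℝ) ^ k * Polynomial.aeval (MvPolynomial.X 0 : MvPolynomial (Fin 2) ℝ) (a k)) = 0 ∧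
      MvPolynomial.eval p
        (MvPolynomial.X 0 * MvPolynomial.pderiv 0 (MvPolynomial.X 0 * MvPolynomial.pderiv 0 (∑ k ∈ Finset.range (r + 1),
        (MvPolynomial.X 1 : MvPolynomial (Fin 2) ℝ) ^ k * Polynomial.aeval (MvPolynomial.X 0 : MvPolynomial (Fin 2) ℝ) (a k)))
            * (MvPolynomial.X 1 * MvPolynomial.pderiv 1 (∑ k ∈ Finset.range (r + 1),
        (MvPolynomial.X 1 : MvPolynomial (Fin 2) ℝ) ^ k * Polynomial.aeval (MvPolynomial.X 0 : MvPolynomial (Fin 2) ℝ) (a k))) ^ 2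
          - 2 * (MvPolynomial.X 0 * MvPolynomial.pderiv 0 (MvPolynomial.X 1 * MvPolynomial.pderiv 1 (∑ k ∈ Finset.range (r + 1),
        (MvPolynomial.X 1 : MvPolynomial (Fin 2) ℝ) ^ k * Polynomial.aeval (MvPolynomial.X 0 : MvPolynomial (Fin 2) ℝ) (a k))))
            * (MvPolynomial.X 0 * MvPolynomial.pderiv 0 (∑ k ∈ Finset.range (r + 1),
        (MvPolynomial.X 1 : MvPolynomial (Fin 2) ℝ) ^ k * Polynomial.aeval (MvPolynomial.X 0 : MvPolynomial (Fin 2) ℝ) (a k)))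
            * (MvPolynomial.X 1 * MvPolynomial.pderiv 1 (∑ k ∈ Finset.range (r + 1),
        (MvPolynomial.X 1 : MvPolynomial (Fin 2) ℝ) ^ k * Polynomial.aeval (MvPolynomial.X 0 : MvPolynomial (Fin 2) ℝ) (a k)))
          + MvPolynomial.X 1 * MvPolynomial.pderiv 1 (MvPolynomial.X 1 * MvPolynomial.pderiv 1 (∑ k ∈ Finset.range (r + 1),
        (MvPolynomial.X 1 : MvPolynomial (Fin 2) ℝ) ^ k * Polynomial.aeval (MvPolynomial.X 0 : MvPolynomial (Fin 2) ℝ) (a k)))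
            * (MvPolynomial.X 0 * MvPolynomial.pderiv 0 (∑ k ∈ Finset.range (r + 1),
        (MvPolynomial.X 1 : MvPolynomial (Fin 2) ℝ) ^ k * Polynomial.aeval (MvPolynomial.X 0 : MvPolynomial (Fin 2) ℝ) (a k))) ^ 2) = 0}.Finite)
    (hgp : ∀ p ∈ {p : Fin 2 → ℝ | 0 < p 0 ∧ 0 < p 1 ∧ MvPolynomial.eval p (∑ k ∈ Finset.range (r + 1),
        (MvPolynomial.X 1 : MvPolynomial (Fin 2) ℝ) ^ k * Polynomial.aeval (MvPolynomial.X 0 : MvPolynomial (Fin 2) ℝ) (a k)) = 0 ∧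
      MvPolynomial.eval p
        (MvPolynomial.X 0 * MvPolynomial.pderiv 0 (MvPolynomial.X 0 * MvPolynomial.pderiv 0 (∑ k ∈ Finset.range (r + 1),
        (MvPolynomial.X 1 : MvPolynomial (Fin 2) ℝ) ^ k * Polynomial.aeval (MvPolynomial.X 0 : MvPolynomial (Fin 2) ℝ) (a k)))
            * (MvPolynomial.X 1 * MvPolynomial.pderiv 1 (∑ k ∈ Finset.range (r + 1),
        (MvPolynomial.X 1 : MvPolynomial (Fin 2) ℝ) ^ k * Polynomial.aeval (MvPolynomial.X 0 : MvPolynomial (Fin 2) ℝ) (a k))) ^ 2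
          - 2 * (MvPolynomial.X 0 * MvPolynomial.pderiv 0 (MvPolynomial.X 1 * MvPolynomial.pderiv 1 (∑ k ∈ Finset.range (r + 1),
        (MvPolynomial.X 1 : MvPolynomial (Fin 2) ℝ) ^ k * Polynomial.aeval (MvPolynomial.X 0 : MvPolynomial (Fin 2) ℝ) (a k))))
            * (MvPolynomial.X 0 * MvPolynomial.pderiv 0 (∑ k ∈ Finset.range (r + 1),
        (MvPolynomial.X 1 : MvPolynomial (Fin 2) ℝ) ^ k * Polynomial.aeval (MvPolynomial.X 0 : MvPolynomial (Fin 2) ℝ) (a k)))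
            * (MvPolynomial.X 1 * MvPolynomial.pderiv 1 (∑ k ∈ Finset.range (r + 1),
        (MvPolynomial.X 1 : MvPolynomial (Fin 2) ℝ) ^ k * Polynomial.aeval (MvPolynomial.X 0 : MvPolynomial (Fin 2) ℝ) (a k)))
          + MvPolynomial.X 1 * MvPolynomial.pderiv 1 (MvPolynomial.X 1 * MvPolynomial.pderiv 1 (∑ k ∈ Finset.range (r + 1),
        (MvPolynomial.X 1 : MvPolynomial (Fin 2) ℝ) ^ k * Polynomial.aeval (MvPolynomial.X 0 : MvPolynomial (Fin 2) ℝ) (a k)))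
            * (MvPolynomial.X 0 * MvPolynomial.pderiv 0 (∑ k ∈ Finset.range (r + 1),
        (MvPolynomial.X 1 : MvPolynomial (Fin 2) ℝ) ^ k * Polynomial.aeval (MvPolynomial.X 0 : MvPolynomial (Fin 2) ℝ) (a k))) ^ 2) = 0},
        MvPolynomial.eval p (MvPolynomial.pderiv 1 (∑ k ∈ Finset.range (r + 1),
        (MvPolynomial.X 1 : MvPolynomial (Fin 2) ℝ) ^ k * Polynomial.aeval (MvPolynomial.X 0 : MvPolynomial (Fin 2) ℝ) (a k))) ≠ 0)
    {ι : Type*} (T : Finset ι) (f : ι → ℝ → ℝ) {s ω : ℝ} (hs : 0 < s) (hsω : s < ω)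
    (hP0 : (∑ k ∈ Finset.range (r + 1), (X : ℝ[X]) ^ k * Polynomial.C ((a k).eval ω)) ≠ 0)
    (hcont : ∀ i ∈ T, ContinuousOn (f i) (Ioo s ω)) (hpos : ∀ i ∈ T, ∀ t ∈ Ioo s ω, 0 < f i t)
    (hsol : ∀ i ∈ T, ∀ t ∈ Ioo s ω, MvPolynomial.eval ![t, f i t] (∑ k ∈ Finset.range (r + 1),
        (MvPolynomial.X 1 : MvPolynomial (Fin 2) ℝ) ^ k * Polynomial.aeval (MvPolynomial.X 0 : MvPolynomial (Fin 2) ℝ) (a k)) = 0)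
    (hinj : ∀ i ∈ T, ∀ j ∈ T, i ≠ j → ∀ t ∈ Ioo s ω, f i t ≠ f j t)
    (hlim : ∀ i ∈ T, Tendsto (f i) (𝓝[<] ω) atTop) :
    T.card ≤ (∑ k ∈ Finset.range (r + 1), (X : ℝ[X]) ^ k * Polynomial.C ((a (r - k)).eval ω)).rootMultiplicity 0 := by
  rcases Nat.eq_zero_or_pos T.card with h0 | hpos'
  · rw [h0]; exact Nat.zero_le _
  · obtain ⟨k, hk⟩ : ∃ k, T.card = k + 1 := ⟨T.card - 1, by omega⟩
    obtain ⟨β, hβ, hchain⟩ := exists_sorted_chain _ _ (eval_coeffForm r a) hsplit hfin hgp T f hs hsω hk hcont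
      hpos hsol hinj
    rw [hk]
    -- the inverses, in reversed order
    have hβpos : ∀ n, n < k + 1 → ∀ t ∈ Ioo s ω, 0 < β n t := by
      intro n hn t ht
      obtain ⟨i, hi, hβi⟩ := hβ n hn
      rw [hβi]; exact hpos i hi t ht
    refine succ_le_rootMultiplicity_of_branches_tendsto_zero _ _ (eval_coeffForm r (fun j => a (r - j))) hsω
      (coeffForm_reflect_ne_zero r a ω hP0) (fun n t => (β (k - n) t)⁻¹) ?_ ?_ ?_
    · intro n hn t ht
      have h1 : β (k - (n + 1)) t < β (k - n) t := by
        have := hchain (k - (n + 1)) (by omega) t ht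
        have e : k - (n + 1) + 1 = k - n := by omega
        rw [e] at this; exact this
      exact inv_strictAnti₀ (hβpos _ (by omega) t ht) h1
    · intro n hn t ht
      obtain ⟨i, hi, hβi⟩ := hβ (k - n) (by omega)
      simp only [hβi]
      exact eval_reflect_coeffForm_inv r a t (hpos i hi t ht).ne' (hsol i hi t ht)
    · intro n hn
      obtain ⟨i, hi, hβi⟩ := hβ (k - n) (by omega)
      simp only [hβi]
      exact (hlim i hi).inv_tendsto_atTop

end OsculationPeel

end Summit.ValiantsHypothesis.ValiantsHypothesis.Theorems.LacunarySymmetroidMatrixDescartes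

end
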